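import Summits.QuantumFields.YangMills.Theorems.BalabanUVNodesN15TwoGridDefectLap
import HarnessLib

/-!
# Route «BalabanUVNodes», node N15 = NE2, -a lane, part 56: BAŁABAN's HÖLDER ENTRY (1.111) AS THE `(j∕n)^α` GAIN OF A `j`-STEP GRADIENT DIFFERENCE
# `ρ(s_κ^j − 1)∘ρ(n(s_ν−1))∘G` IN BLOCK-MAJORANT CURRENCY, `4j ≤ n` (generic lattice; the multi-step form of part 41)

Cell `pub-ymgap`, seat `pub-ymgap-dag-n15-a` (KNIT-BY-NAME, g13); `--kind proof --supports stmt-QuantumFields-20294 --as helper`.  Over part 41 (`…N15TwoGridHolder`: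
the ONE-step difference `ρ(n(s_ν−1))∘ρ(n(s_{ν′}−1))∘G`, majorant `C·n^{1−α}·e^{−δ₀d}`) and part 42 (`…N15TwoGridEntries`: `suppInL_vec_of_isLoc`, `supNormL_vec_le_loc`).
WHY.  The sequel (part 58, entry 1 `𝔇(∇G) = ∇′G′P − P∇G` of [B9] (3.42) for Bałaban's pair `(G′, G)` at `U ≡ 1`) is an INTERPOLATION: the mean-value identity
`n′(s−1) = (n′∕r)(s^r − 1) − r⁻¹Σ_{j<r}(s^j − 1)·n′(s−1)` bounds `∇′_ν(F₂λ)` by `(2n′∕r)·sup|F₂λ|` plus the OSCILLATIONS of `∇′G′(Pλ)` and of `∇Gλ` over `j ≤ r` lattice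
steps, `r∕n′ ≫ η`.  Those oscillations are exactly what (1.111) `‖ζ∇GJ‖_α ≤ O(1)e^{−δ₀|y−y′|}(‖ζ‖_α + |ζ|)|J|` controls for pairs at physical distance `j∕n ≤ ¼` (the plateau
of lit-balaban's cut-off `cutP (nearOf x)`): `|∇_{ν}Gμ(x + je_κ) − ∇_{ν}Gμ(x)| ≤ ‖ζ∇Gμ‖_α·(j∕n)^α`.  Part 41 typed the case `j = 1`; THIS FILE types `1 ≤ j`, `4j ≤ n`, with the
same constant `|C_α(α)|·(Lθ+1)·e^{δ₀}` and NO factor `n` (the shift `s_κ^j − 1` carries no lattice factor).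
CONTENTS.  §64 geometry of `j` steps: `natAbs_valMinAbs_natCast_le'`, `distU_add_smul_le` (`|x − (x + je_κ)| ≤ j∕n`), `distU_add_smul_pos` (`> 0` for `1 ≤ j ≤ n`, `M_κ ≥ 2`).
§65 ★ `abs_holderSteps_le_of_ineq` (the pair bound at distance `j∕n ≤ ¼` from the (1.111) clause of `B5.Ineq110_114`, any setting).  §66 ★★ `hasMaj_holderSteps_of_ineq`:
`HasMaj (ofBlocks … blockOf) (ofBlocks … blockOf) (ρ(s_κ^j − 1)∘ρ(n(s_ν−1))∘G) (|C_α|(Lθ+1)e^{δ₀}·(j∕n)^α·e^{−δ₀|y−y′|_T})` for `4j ≤ n`, `M_μ ≥ 2` (the case `j = 0` is the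
zero operator).  §67 `hasMaj_holderSteps_pair`: the η-pair of record (`n = L^k` and `n′ = L^m·L^k`, ONE constant pair from `ineq110_114_pair`).
HONEST FRAMING ∕ LIMITS.  Dictionary + bookkeeping over the tree's theorem `prop12_famG_printed` ((1.111) clause) and lit-balaban's cut-off geometry; constants crude; tori of record
(`M_μ = 2L^{m_T}`) in §67 only; `U ≡ 1`; NO η-rate here (entry 1 is part 58); count-neutral (typed 28∕28 · discharged 5∕27 of record unchanged); NOT a discharge of N15
(object-bound; NE2⁺ NOT PRINTED); one finite T⁴ at fixed ε — NOT infinite volume, NOT OS on ℝ⁴, NOT a mass gap, NOT Clay.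
-/

noncomputable section

open scoped BigOperators Matrix
open Finset

namespace Summit.QuantumFields.YangMills.BalabanUVNodes.N15.TwoGrid

open Literature.MathematicalPhysics.QuantumFieldTheory.Balaban1983to89
open Literature.MathematicalPhysics.QuantumFieldTheory.Balaban1983to89.B11SectG (BlockNorm HasMaj hasMaj_zero)
open Literature.MathematicalPhysics.QuantumFieldTheory.Balaban1983to89.B11AxialTransport190 (abs_le_loc_ofBlocks loc_ofBlocks_le)
open Literature.MathematicalPhysics.QuantumFieldTheory.Balaban1983to89.B5Prop11Plancherel (Tor fine unitVec)
open Literature.MathematicalPhysics.QuantumFieldTheory.Balaban1983to89.B5RealFields (cplx)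
open Literature.MathematicalPhysics.QuantumFieldTheory.Balaban1983to89.B5Prop12FieldsLattice (cdistF distSite distU suppInL supNormL h1L holderT cutHL
  distU_nonneg supNormL_nonneg cutHL_nonneg)
open Literature.MathematicalPhysics.QuantumFieldTheory.Balaban1983to89.B5SettingP12Real (LocR VecR latticeSettingP12R)
open Literature.MathematicalPhysics.QuantumFieldTheory.Balaban1983to89.B5SiteBridgeP12 (MP distU_eq_distSite_div)
open Literature.MathematicalPhysics.QuantumFieldTheory.Balaban1983to89.B5CoverP12Lattice (cutP nearOf Lθ Lθ_nonneg cutP_nearOf_eq_one cutP_nearOf_eq_one_of_distU_le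
  cutInL_cutP)
open Literature.MathematicalPhysics.QuantumFieldTheory.Balaban1983to89.B5GlobCoverP12Lattice (cutH_le)
open Literature.MathematicalPhysics.QuantumFieldTheory.Balaban1983to89.B5SupHolderTorus (abs_sub_le_holderT_mul)
open Literature.MathematicalPhysics.QuantumFieldTheory.Balaban1983to89.B5RowSumsP12Lattice (distSite_triangle)
open Literature.MathematicalPhysics.QuantumFieldTheory.Balaban1983to89.LatticeNorms (holderSeminorm_nonneg)
open Literature.MathematicalPhysics.QuantumFieldTheory.King1986.Torus (blockOf tdistT tdistT_nonneg tdistT_symm)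
open Literature.MathematicalPhysics.QuantumFieldTheory.Balaban1983to89.B6UnitTorusCarrier (unitTorusGeo)
open Summit.QuantumFields.YangMills.BalabanUVNodes.N15.VectorPiece (blkFine)

variable {d : ℕ}

/-! ## §64 Geometry: `j` fine steps have length `j∕n`, and positive length for `1 ≤ j ≤ n` -/

section Geometry

variable (M : Fin (d + 1) → ℕ) [∀ μ, NeZero (M μ)] (n : ℕ) [NeZero n]

/-- `|valMinAbs (m : ℤ∕N)| ≤ m` for a natural number `m` (the tree's private `natAbs_valMinAbs_natCast_le` of `B5CombesThomasLattice`, restated for use here). [folklore] -/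
theorem natAbs_valMinAbs_natCast_le' (N m : ℕ) [NeZero N] : ((m : ZMod N).valMinAbs).natAbs ≤ m := by
  rw [ZMod.valMinAbs_natAbs_eq_min, ZMod.val_natCast]
  exact (min_le_left _ _).trans (Nat.mod_le m N)

omit [∀ μ, NeZero (M μ)] [NeZero n] in
/-- the coordinate differences of `x` and `x + je_κ`: `−j` in direction `κ`, `0` elsewhere. [folklore] -/
theorem sub_add_smul_unitVec_apply (x : Tor (fine n M)) (κ μ : Fin (d + 1)) (j : ℕ) :
    x μ - (x + j • unitVec (fine n M) κ) μ = -((j • unitVec (fine n M) κ) μ) := by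
  simp only [Pi.add_apply]; ring

/-- **`j` FINE STEPS HAVE LENGTH `≤ j∕n` IN UNITS**: `|x − (x + je_κ)| ≤ j∕n`. [cite: Balaban1984PropagatorsI, (1.109) p.35 (|x − x′|)] -/
theorem distU_add_smul_le (x : Tor (fine n M)) (κ : Fin (d + 1)) (j : ℕ) : distU n M x (x + j • unitVec (fine n M) κ) ≤ (j : ℝ) / n := by
  rw [distU_eq_distSite_div]
  have hn : (0 : ℝ) < n := by exact_mod_cast Nat.pos_of_ne_zero (NeZero.ne n)
  refine div_le_div_of_nonneg_right ?_ hn.le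
  unfold distSite
  have h : (Finset.univ.sup fun μ => ((x μ - (x + j • unitVec (fine n M) κ) μ).valMinAbs).natAbs) ≤ j := by
    refine Finset.sup_le fun μ _ => ?_
    rw [sub_add_smul_unitVec_apply, ZMod.natAbs_valMinAbs_neg, Pi.smul_apply]
    unfold unitVec
    by_cases hμ : μ = κ
    · subst hμ
      rw [Pi.single_eq_same, nsmul_eq_mul, mul_one]
      exact natAbs_valMinAbs_natCast_le' (fine n M μ) j
    · rw [Pi.single_eq_of_ne hμ, smul_zero, ZMod.valMinAbs_zero]; simp
  exact_mod_cast h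

/-- **… AND POSITIVE LENGTH** for `1 ≤ j ≤ n` on tori with `M_κ ≥ 2` unit cubes in direction `κ` (then `j ≤ n ≤ nM_κ∕2`, no wrap-around): `0 < |x − (x + je_κ)|`.
[cite: Balaban1984PropagatorsI, (1.109) p.35 (|x − x′|)] -/
theorem distU_add_smul_pos (hM2 : ∀ μ, 2 ≤ M μ) (x : Tor (fine n M)) (κ : Fin (d + 1)) {j : ℕ} (hj1 : 1 ≤ j) (hjn : j ≤ n) :
    0 < distU n M x (x + j • unitVec (fine n M) κ) := by
  rw [distU_eq_distSite_div]
  have hn : (0 : ℝ) < n := by exact_mod_cast Nat.pos_of_ne_zero (NeZero.ne n)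
  refine div_pos ?_ hn
  have hκ : ((x κ - (x + j • unitVec (fine n M) κ) κ).valMinAbs).natAbs = j := by
    rw [sub_add_smul_unitVec_apply, ZMod.natAbs_valMinAbs_neg, Pi.smul_apply]
    unfold unitVec
    rw [Pi.single_eq_same, nsmul_eq_mul, mul_one, ZMod.valMinAbs_natCast_of_le_half]
    · rfl
    · have h2 : 2 * j ≤ fine n M κ := by
        show 2 * j ≤ n * M κ
        calc 2 * j ≤ 2 * n := Nat.mul_le_mul_left 2 hjn
          _ = n * 2 := Nat.mul_comm _ _
          _ ≤ n * M κ := Nat.mul_le_mul_left n (hM2 κ)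
      omega
  have hle : ((x κ - (x + j • unitVec (fine n M) κ) κ).valMinAbs).natAbs
      ≤ Finset.univ.sup fun μ => ((x μ - (x + j • unitVec (fine n M) κ) μ).valMinAbs).natAbs :=
    Finset.le_sup (f := fun μ => ((x μ - (x + j • unitVec (fine n M) κ) μ).valMinAbs).natAbs) (Finset.mem_univ κ)
  rw [hκ] at hle
  unfold distSite
  exact_mod_cast Nat.lt_of_lt_of_le (Nat.lt_of_lt_of_le Nat.zero_lt_one hj1) hle

end Geometry

/-! ## §65 The `j`-step gradient difference through the HÖLDER ENTRY (1.111): `|∇_νGμ(x + je_κ) − ∇_νGμ(x)| ≤ C_α·e^{−δ₀|y₀−y′|}·(‖ζ‖_α + |ζ|)·|μ|·(j∕n)^α` -/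

section Steps

variable (M : Fin (d + 1) → ℕ) [∀ μ, NeZero (M μ)] (n : ℕ) [NeZero n] (a : ℝ)

/-- ★ **`j` FINE STEPS COST `(j∕n)^α` ON `∇G`, BY (1.111)**, `1 ≤ j`, `4j ≤ n`, `M_κ ≥ 2`: with `ζ = cutP (nearOf x)` (plateau `= 1` within `¼` of `x`),
`|ρ(n(s_ν−1))(Gμ)(x + je_κ, ι) − ρ(n(s_ν−1))(Gμ)(x, ι)| ≤ ‖ζ∇Gμ‖_α·(j∕n)^α ≤ C_α(α)·e^{−δ₀|nearOf x − y′|}·(‖ζ‖_α + |ζ|)·|μ|·(j∕n)^α` for `supp μ ⊂ Δ̃(y′)` — the (1.111)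
clause of `B5.Ineq110_114` at the concrete setting, unpacked (part 41 §22 is the case `j = 1`). [cite: Balaban1984PropagatorsI, Prop. 1.2 (1.111) p.35] -/
theorem abs_holderSteps_le_of_ineq (hM2 : ∀ μ, 2 ≤ M μ) {j : ℕ} (hj1 : 1 ≤ j) (hj : 4 * j ≤ n) {K : ℕ} {C δ₀ : ℝ} {Cα Cε : ℝ → ℝ} {Cαε : ℝ → ℝ → ℝ}
    (H : B5.Ineq110_114 (latticeSettingP12R n M a K) C Cα Cε Cαε δ₀) {α : ℝ} (hα0 : 0 ≤ α) (hα1 : α < 1)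
    (μ : Tor (fine n M) × Fin (d + 1) → ℝ) {y' : Tor M} (hμ : suppInL n M (LocR.vec μ).emb y') (κ ν : Fin (d + 1))
    (x : Tor (fine n M)) (ι : Fin (d + 1)) :
    |symbOp M n (sD M n ν n) (gOp M n a μ) (x + j • unitVec (fine n M) κ, ι) - symbOp M n (sD M n ν n) (gOp M n a μ) (x, ι)|
      ≤ Cα α * Real.exp (-(δ₀ * distSite M (nearOf M n x) y')) * cutHL n M α (cutP M n (nearOf M n x))
          * supNormL n M (LocR.vec μ).emb * ((j : ℝ) / n) ^ α := by
  have hn1 : 1 ≤ n := by omega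
  have hn0 : (0 : ℝ) < n := by exact_mod_cast (show 0 < n by omega)
  set ζ : Tor (fine n M) → ℝ := cutP M n (nearOf M n x) with hζ
  set T : Fin (d + 1) → VecR n M := fun ν'' b => ζ b.1 * symbOp M n (sD M n ν'' n) (gOp M n a μ) b with hT
  have h111 : h1L n M a (LocR.vec μ).emb α ζ
      ≤ Cα α * Real.exp (-(δ₀ * distSite M (nearOf M n x) y')) * cutHL n M α ζ * supNormL n M (LocR.vec μ).emb :=
    H.2.1 α (LocR.vec μ) ζ (nearOf M n x) y' hα0 hα1 (cutInL_cutP M n hn1 _) hμ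
  rw [h1L_vec_eq] at h111
  have hdj : distU n M x (x + j • unitVec (fine n M) κ) ≤ (j : ℝ) / n := distU_add_smul_le M n x κ j
  have hj4 : (j : ℝ) / n ≤ 1 / 4 := by
    rw [div_le_div_iff₀ hn0 (by norm_num : (0 : ℝ) < 4), one_mul]
    exact_mod_cast (show j * 4 ≤ n by omega)
  have hpos : 0 < distU n M x (x + j • unitVec (fine n M) κ) := distU_add_smul_pos M n hM2 x κ hj1 (by omega)
  have hpair := abs_sub_le_holderT_mul α T ν (μ := ι) (hdj.trans (hj4.trans (by norm_num))) hpos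
  have hζ0 : ζ x = 1 := cutP_nearOf_eq_one M n hn1 x
  have hζ1 : ζ (x + j • unitVec (fine n M) κ) = 1 := cutP_nearOf_eq_one_of_distU_le M n hn1 (hdj.trans hj4)
  have hT0 : T ν (x, ι) = symbOp M n (sD M n ν n) (gOp M n a μ) (x, ι) := by simp only [hT, hζ0, one_mul]
  have hT1 : T ν (x + j • unitVec (fine n M) κ, ι) = symbOp M n (sD M n ν n) (gOp M n a μ) (x + j • unitVec (fine n M) κ, ι) := by
    simp only [hT, hζ1, one_mul]
  rw [← hT0, ← hT1]
  have hhol0 : 0 ≤ holderT n M α (fun ν => cplx (T ν)) := by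
    unfold holderT LatticeNorms.holderSeminormB5
    exact holderSeminorm_nonneg _ _ _ _ _ _
  refine hpair.trans (mul_le_mul h111 ?_ (Real.rpow_nonneg (distU_nonneg _ _) _) (hhol0.trans h111))
  exact Real.rpow_le_rpow (distU_nonneg _ _) hdj hα0

/-! ## §66 The block majorant of `ρ(s_κ^j − 1)∘ρ(n(s_ν−1))∘G`: `|C_α|(Lθ+1)e^{δ₀}·(j∕n)^α·e^{−δ₀|y−y′|_T}` -/

omit [∀ μ, NeZero (M μ)] [NeZero n] in
/-- pointwise form of the `j`-step difference operator `ρ(s_κ^j − 1)`. [folklore] -/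
theorem symbOp_sT_pow_sub_one_apply (κ : Fin (d + 1)) (j : ℕ) (f : Tor (fine n M) × Fin (d + 1) → ℝ) (i : Tor (fine n M) × Fin (d + 1)) :
    symbOp M n (sT M n κ ^ j - 1) f i = f (i.1 + j • unitVec (fine n M) κ, i.2) - f i := by
  rw [map_sub, map_one, LinearMap.sub_apply, Module.End.one_apply, Pi.sub_apply, symbOp_sT_pow_apply]

/-- ★★ **THE `j`-STEP GRADIENT DIFFERENCE `ρ(s_κ^j − 1)∘ρ(n(s_ν−1))∘G` HAS THE BLOCK MAJORANT `C′·(j∕n)^α·e^{−δ₀|y−y′|_T}`**, `C′ = |C_α(α)|·(Lθ+1)·e^{δ₀}`, for every setting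
satisfying `B5.Ineq110_114` ((1.111) clause), `4j ≤ n`, tori with `≥ 2` unit cubes per direction: the oscillation of `∇G` over `j` lattice steps (physical distance `j∕n ≤ ¼`)
in the lineage's `HasMaj` currency (King unit blocks on the carrier `unitTorusGeo L k M`; the observation point `x + je_κ` lies at most one unit from `B(x)`, absorbed with
`nearOf x` into `e^{δ₀}`).  `j = 0` is the zero operator. [cite: Balaban1984PropagatorsI, Prop. 1.2 (1.111) p.35] -/
theorem hasMaj_holderSteps_of_ineq {L k : ℕ} (hM2 : ∀ μ, 2 ≤ M μ) {j : ℕ} (hj : 4 * j ≤ n) {K : ℕ} {C δ₀ : ℝ} {Cα Cε : ℝ → ℝ} {Cαε : ℝ → ℝ → ℝ}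
    (H : B5.Ineq110_114 (latticeSettingP12R n M a K) C Cα Cε Cαε δ₀) (hδ₀ : 0 ≤ δ₀) {α : ℝ} (hα0 : 0 ≤ α) (hα1 : α < 1)
    (κ ν : Fin (d + 1)) :
    HasMaj (BlockNorm.ofBlocks (unitTorusGeo L k M) (fun i : Tor (fine n M) × Fin (d + 1) => blockOf n M i.1))
      (BlockNorm.ofBlocks (unitTorusGeo L k M) (fun i : Tor (fine n M) × Fin (d + 1) => blockOf n M i.1))
      (symbOp M n (sT M n κ ^ j - 1) ∘ₗ symbOp M n (sD M n ν n) ∘ₗ gOp M n a)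
      (fun y y' => |Cα α| * (Lθ (d + 1) + 1) * Real.exp δ₀ * ((j : ℝ) / n) ^ α * Real.exp (-(δ₀ * tdistT M y y'))) := by
  have hn0 : (0 : ℝ) < n := by exact_mod_cast Nat.pos_of_ne_zero (NeZero.ne n)
  have hjn0 : 0 ≤ (j : ℝ) / n := div_nonneg (Nat.cast_nonneg j) hn0.le
  have hK0 : ∀ y y' : Tor M, 0 ≤ |Cα α| * (Lθ (d + 1) + 1) * Real.exp δ₀ * ((j : ℝ) / n) ^ α * Real.exp (-(δ₀ * tdistT M y y')) := fun y y' =>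
    mul_nonneg (mul_nonneg (mul_nonneg (mul_nonneg (abs_nonneg _) (by linarith [Lθ_nonneg (d + 1)])) (Real.exp_nonneg _))
      (Real.rpow_nonneg hjn0 _)) (Real.exp_nonneg _)
  by_cases hj0 : j = 0
  · subst hj0
    have hz : symbOp M n (sT M n κ ^ 0 - 1) ∘ₗ symbOp M n (sD M n ν n) ∘ₗ gOp M n a = 0 := by
      rw [pow_zero, sub_self, map_zero, LinearMap.zero_comp]
    rw [hz]
    exact (hasMaj_zero _ _).mono fun y y' => hK0 y y'
  have hj1 : 1 ≤ j := Nat.one_le_iff_ne_zero.mpr hj0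
  have hn1 : 1 ≤ n := by omega
  intro y' μ hμ y
  set b₁ := BlockNorm.ofBlocks (unitTorusGeo L k M) (fun i : Tor (fine n M) × Fin (d + 1) => blockOf n M i.1) with hb₁
  have hsupp : suppInL n M (LocR.vec μ).emb y' := suppInL_vec_of_isLoc M k n hn1 hμ
  have hsrc : supNormL n M (LocR.vec μ).emb ≤ b₁.loc y' μ := supNormL_vec_le_loc M k n hμ
  refine loc_ofBlocks_le (g := unitTorusGeo L k M) (fun i : Tor (fine n M) × Fin (d + 1) => blockOf n M i.1) _
    (mul_nonneg (hK0 y y') (b₁.loc_nonneg y' μ)) fun b hb => ?_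
  obtain ⟨x, ι⟩ := b
  rw [LinearMap.comp_apply, LinearMap.comp_apply, symbOp_sT_pow_sub_one_apply]
  have hstep := abs_holderSteps_le_of_ineq M n a hM2 hj1 hj H hα0 hα1 μ hsupp κ ν x ι
  have hnear : tdistT M (nearOf M n x) (blockOf n M x) ≤ 1 := tdistT_nearOf_blockOf_le M n hn1 x
  have hexp : Real.exp (-(δ₀ * distSite M (nearOf M n x) y')) ≤ Real.exp δ₀ * Real.exp (-(δ₀ * tdistT M y y')) := by
    have htri := distSite_triangle M y (nearOf M n x) y'
    simp only [distSite_eq_tdistT] at htri ⊢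
    have hyn : tdistT M y (nearOf M n x) ≤ 1 := by
      rw [tdistT_symm, ← (show blockOf n M x = y from hb)]; exact hnear
    rw [← Real.exp_add, Real.exp_le_exp]
    have h1 : δ₀ * tdistT M y y' ≤ δ₀ * tdistT M y (nearOf M n x) + δ₀ * tdistT M (nearOf M n x) y' := by
      rw [← mul_add]; exact mul_le_mul_of_nonneg_left htri hδ₀
    have h2 : δ₀ * tdistT M y (nearOf M n x) ≤ δ₀ := mul_le_of_le_one_right hδ₀ hyn
    linarith
  have hcut : cutHL n M α (cutP M n (nearOf M n x)) ≤ Lθ (d + 1) + 1 := cutH_le M n hM2 α _ hα1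
  have hE := Real.exp_nonneg (-(δ₀ * distSite M (nearOf M n x) y'))
  have hH := cutHL_nonneg (n := n) (M := M) α (cutP M n (nearOf M n x))
  have hS := supNormL_nonneg (n := n) (M := M) (LocR.vec μ).emb
  have hA := abs_nonneg (Cα α)
  have hE1 : 0 ≤ Real.exp δ₀ * Real.exp (-(δ₀ * tdistT M y y')) := by positivity
  have hL1 : 0 ≤ Lθ (d + 1) + 1 := by linarith [Lθ_nonneg (d + 1)]
  calc |symbOp M n (sD M n ν n) (gOp M n a μ) (x + j • unitVec (fine n M) κ, ι) - symbOp M n (sD M n ν n) (gOp M n a μ) (x, ι)|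
      ≤ Cα α * Real.exp (-(δ₀ * distSite M (nearOf M n x) y')) * cutHL n M α (cutP M n (nearOf M n x)) * supNormL n M (LocR.vec μ).emb * ((j : ℝ) / n) ^ α :=
        hstep
    _ ≤ |Cα α| * (Real.exp δ₀ * Real.exp (-(δ₀ * tdistT M y y'))) * (Lθ (d + 1) + 1) * b₁.loc y' μ * ((j : ℝ) / n) ^ α := by
        refine mul_le_mul_of_nonneg_right ?_ (Real.rpow_nonneg hjn0 _)
        calc Cα α * Real.exp (-(δ₀ * distSite M (nearOf M n x) y')) * cutHL n M α (cutP M n (nearOf M n x)) * supNormL n M (LocR.vec μ).emb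
            ≤ |Cα α| * Real.exp (-(δ₀ * distSite M (nearOf M n x) y')) * cutHL n M α (cutP M n (nearOf M n x)) * supNormL n M (LocR.vec μ).emb := by
              gcongr; exact le_abs_self _
          _ ≤ |Cα α| * (Real.exp δ₀ * Real.exp (-(δ₀ * tdistT M y y'))) * (Lθ (d + 1) + 1) * b₁.loc y' μ :=
              mul_le_mul (mul_le_mul (mul_le_mul_of_nonneg_left hexp hA) hcut hH (mul_nonneg hA hE1)) hsrc hS (mul_nonneg (mul_nonneg hA hE1) hL1)
    _ = |Cα α| * (Lθ (d + 1) + 1) * Real.exp δ₀ * ((j : ℝ) / n) ^ α * Real.exp (-(δ₀ * tdistT M y y')) * b₁.loc y' μ := by ring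

end Steps

/-! ## §67 THE η-PAIR OF RECORD: `j`-step oscillation majorants of `∇G` (coarse, `n = L^k`) and of `∇′G′` (fine, `n′ = L^m·L^k`), one constant pair -/

section Pair

/-- ★ **MULTI-STEP (1.111) ON BOTH MEMBERS OF THE η-PAIR OF RECORD**: for odd `L > 1`, `a > 0`, `0 ≤ α < 1` there are `δ₀, C > 0` such that for every torus exponent `m_T`, every
`k ≥ 1`, every refinement exponent `m`, all directions `κ, ν` and every step count `j`: (coarse) if `4j ≤ L^k` then `ρ(s_κ^j − 1)∘ρ(L^k(s_ν−1))∘G` has the block majorant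
`C·(j∕L^k)^α·e^{−δ₀|y−y′|_T}`; (fine) if `4j ≤ L^m·L^k` then `ρ′(s_κ^j − 1)∘ρ′(L^mL^k(s_ν−1))∘G′` has `C·(j∕(L^m·L^k))^α·e^{−δ₀|y−y′|_T}` (fine 1-forms blocked by King's unit
blocks of the fine lattice).  From `ineq110_114_pair` (part 42) through §66. [cite: Balaban1984PropagatorsI, Prop. 1.2 (1.111) p.35] -/
theorem hasMaj_holderSteps_pair {L : ℕ} [NeZero L] (hL : Odd L ∧ 1 < L) {a : ℝ} (ha : 0 < a) {α : ℝ} (hα0 : 0 ≤ α) (hα1 : α < 1) :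
    ∃ δ₀ C : ℝ, 0 < δ₀ ∧ 0 < C ∧ ∀ (mT k m : ℕ) (hk : 1 ≤ k) (κ ν : Fin (d + 1)) (j : ℕ),
      (4 * j ≤ L ^ k →
        HasMaj (BlockNorm.ofBlocks (unitTorusGeo L k (MP (paramsOf d L mT k hL))) (blkFine L k (MP (paramsOf d L mT k hL))))
          (BlockNorm.ofBlocks (unitTorusGeo L k (MP (paramsOf d L mT k hL))) (blkFine L k (MP (paramsOf d L mT k hL))))
          (symbOp (MP (paramsOf d L mT k hL)) (L ^ k) (sT (MP (paramsOf d L mT k hL)) (L ^ k) κ ^ j - 1) ∘ₗ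
            symbOp (MP (paramsOf d L mT k hL)) (L ^ k) (sD (MP (paramsOf d L mT k hL)) (L ^ k) ν ((L ^ k : ℕ) : ℝ)) ∘ₗ
              gOp (MP (paramsOf d L mT k hL)) (L ^ k) a)
          (fun y y' => C * ((j : ℝ) / ((L ^ k : ℕ) : ℝ)) ^ α * Real.exp (-(δ₀ * tdistT (MP (paramsOf d L mT k hL)) y y')))) ∧
      (4 * j ≤ L ^ m * L ^ k →
        HasMaj (BlockNorm.ofBlocks (unitTorusGeo L k (MP (paramsOf d L mT k hL)))
            (fun i : Tor (fine (L ^ m * L ^ k) (MP (paramsOf d L mT k hL))) × Fin (d + 1) => blockOf (L ^ m * L ^ k) (MP (paramsOf d L mT k hL)) i.1))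
          (BlockNorm.ofBlocks (unitTorusGeo L k (MP (paramsOf d L mT k hL)))
            (fun i : Tor (fine (L ^ m * L ^ k) (MP (paramsOf d L mT k hL))) × Fin (d + 1) => blockOf (L ^ m * L ^ k) (MP (paramsOf d L mT k hL)) i.1))
          (symbOp (MP (paramsOf d L mT k hL)) (L ^ m * L ^ k) (sT (MP (paramsOf d L mT k hL)) (L ^ m * L ^ k) κ ^ j - 1) ∘ₗ
            symbOp (MP (paramsOf d L mT k hL)) (L ^ m * L ^ k) (sD (MP (paramsOf d L mT k hL)) (L ^ m * L ^ k) ν ((L ^ m * L ^ k : ℕ) : ℝ)) ∘ₗ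
              gOp (MP (paramsOf d L mT k hL)) (L ^ m * L ^ k) a)
          (fun y y' => C * ((j : ℝ) / ((L ^ m * L ^ k : ℕ) : ℝ)) ^ α * Real.exp (-(δ₀ * tdistT (MP (paramsOf d L mT k hL)) y y')))) := by
  obtain ⟨δ₀, C₀, Cα, Cε, Cαε, hδ₀, _hC₀, HP⟩ := ineq110_114_pair (d := d) hL ha
  refine ⟨δ₀, |Cα α| * (Lθ (d + 1) + 1) * Real.exp δ₀ + 1, hδ₀, ?_, fun mT k m hk κ ν j => ?_⟩
  · have : 0 ≤ |Cα α| * (Lθ (d + 1) + 1) * Real.exp δ₀ :=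
      mul_nonneg (mul_nonneg (abs_nonneg _) (by linarith [Lθ_nonneg (d + 1)])) (Real.exp_nonneg _)
    linarith
  set M : Fin (d + 1) → ℕ := MP (paramsOf d L mT k hL) with hM
  have hL0 : 0 < L := Nat.pos_of_ne_zero (NeZero.ne L)
  have hM2 : ∀ μ, 2 ≤ M μ := fun μ => Nat.le_mul_of_pos_right 2 (pow_pos hL0 mT)
  have hmono : ∀ (t : ℝ) (ht : 0 ≤ t) (y y' : Tor M),
      |Cα α| * (Lθ (d + 1) + 1) * Real.exp δ₀ * t ^ α * Real.exp (-(δ₀ * tdistT M y y'))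
        ≤ (|Cα α| * (Lθ (d + 1) + 1) * Real.exp δ₀ + 1) * t ^ α * Real.exp (-(δ₀ * tdistT M y y')) := fun t ht y y' =>
    mul_le_mul_of_nonneg_right (mul_le_mul_of_nonneg_right (by linarith) (Real.rpow_nonneg ht _)) (Real.exp_nonneg _)
  refine ⟨fun hj => ?_, fun hj => ?_⟩
  · have h := hasMaj_holderSteps_of_ineq (L := L) (k := k) M (L ^ k) a hM2 hj (HP mT k m hk).1 hδ₀.le hα0 hα1 κ ν
    exact h.mono fun y y' => hmono _ (div_nonneg (Nat.cast_nonneg j) (Nat.cast_nonneg _)) y y'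
  · have h := hasMaj_holderSteps_of_ineq (L := L) (k := k) M (L ^ m * L ^ k) a hM2 hj (HP mT k m hk).2 hδ₀.le hα0 hα1 κ ν
    exact h.mono fun y y' => hmono _ (div_nonneg (Nat.cast_nonneg j) (Nat.cast_nonneg _)) y y'

end Pair

end Summit.QuantumFields.YangMills.BalabanUVNodes.N15.TwoGrid
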